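import Mathlib
import Summits.ValiantsHypothesis.ValiantsHypothesis.Theorems.NewtonUnitEquationsNewtonTauWeakSumsetChartCount
import Summits.ValiantsHypothesis.ValiantsHypothesis.Theorems.NewtonUnitEquationsNewtonTauWeakFourCoreSplitting

/-!
# `NewtonUnitEquationsNewtonTauWeakCoreSplitting` — Minkowski splitting of a `c`-core design along `c = a + b`

Line `binomial-normal-form` of crux `NewtonTauWeak` (stmt-ValiantsHypothesis-5904), lead c7, stub P7: the general
MINKOWSKI SPLITTING THEOREM in chart language.  A design on `c = a + b` cores is
`h : Fin (a + b) → Finset (Fin x) → ℕ²`; a configuration `f : Fin x → Fin (a + b)` (attached element `u` joins core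
`f u`) has the point `P f = Σ_d h d (f⁻¹ d)`.  For a finite `S ⊆ ℕ²` the CHART POINTS of `S` (chart `σ = −1`) are the
`p ∈ S` that are the unique maximiser over `S` of some height `q ↦ t·q₀ − q₁`, `t ∈ ℝ` (the lower-hull vertices).
The stub bounds `|U(im P)| + 2^x` by `Σ_{W ⊆ [x]} (|U(A_W)| + |U(B_W)|)`, where `A_W` is the cloud of the
SUB-DESIGN on the first `a` cores read only on `Wᶜ` (`φ : Fin x → Fin a ↦ Σ_{d<a} h (castAdd b d) (Wᶜ ∩ φ⁻¹ d)`)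
and `B_W` the cloud of the sub-design on the last `b` cores read only on `W`
(`ψ : Fin x → Fin b ↦ Σ_{d<b} h (natAdd a d) (W ∩ ψ⁻¹ d)`).

Proof (the argument of the model case `stub_fourCoreSplitting`, `a = b = 2`).  Condition on the slice
`W = f⁻¹(second block)`.  GLUING (`sum_glue`): the configuration glued from `φ` off `W` and `ψ` on `W` has point
`A`-summand `+` `B`-summand, so the planar sumset `A_W ⊕ B_W` lies in `im P`; SLICING (`exists_glue`): every `f` is
so glued from its own slice, so `P f ∈ A_W ⊕ B_W`.  Hence a chart point of `im P` is a chart point (same `t`) of the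
sumset of its own slice, `U(im P) ⊆ ⋃_W U(A_W ⊕ B_W)`, and by the chart lemma for planar Minkowski sums (the landed
brick `stub_sumsetChartCount`, `σ = −1 ≠ 0`) `|U(A_W ⊕ B_W)| + 1 ≤ |U(A_W)| + |U(B_W)|` for each of the `2^x` slices
(`A_W`, `B_W` are nonempty because `1 ≤ a`, `1 ≤ b`).  Summing over `W` gives the claim; everything stays in `ℕ` in the
shape `· + 2^x ≤ ·`.

`stub_coreSplitting` is the registered stub text, verbatim; it is a one-line specialisation of `core_bound`, the same
statement with the three point maps abstracted.  Folklore-level; Mathlib and the landed bricks only; no citations,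
no `def`s.
-/

-- Sub = Summit single-conjunct layout: the duplicated namespace component is mandated by the tree.
set_option linter.dupNamespace false

open scoped BigOperators

namespace Summit.ValiantsHypothesis.ValiantsHypothesis.Theorems.NewtonUnitEquationsNewtonTauWeak

namespace CoreSplittingAux

/-- FIBRES OF A GLUED CONFIGURATION, first block: the configuration glued from `φ` off `W` and `ψ` on `W` has fibre
`Wᶜ ∩ φ⁻¹ i` over the core `castAdd b i`. [folklore] -/
theorem filter_glue_castAdd {a b x : ℕ} (W : Finset (Fin x)) (φ : Fin x → Fin a) (ψ : Fin x → Fin b)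
    (g : Fin x → Fin (a + b)) (hg : ∀ u, g u = if u ∈ W then Fin.natAdd a (ψ u) else Fin.castAdd b (φ u))
    (i : Fin a) :
    (Finset.univ.filter fun u => g u = Fin.castAdd b i) = Wᶜ ∩ Finset.univ.filter fun u => φ u = i := by
  ext u
  simp only [Finset.mem_filter, Finset.mem_univ, true_and, Finset.mem_inter, Finset.mem_compl]
  rw [hg u]
  by_cases hu : u ∈ W
  · simp only [hu, ↓reduceIte, not_true_eq_false, false_and, iff_false]
    -- a second-block core `natAdd a j` (value `a + j`) is never a first-block core `castAdd b i` (value `i < a`)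
    exact Fin.ne_of_val_ne (by simp only [Fin.val_natAdd, Fin.val_castAdd]; omega)
  · simp only [hu, ↓reduceIte, not_false_eq_true, true_and, Fin.castAdd_inj]

/-- FIBRES OF A GLUED CONFIGURATION, second block: the configuration glued from `φ` off `W` and `ψ` on `W` has fibre
`W ∩ ψ⁻¹ j` over the core `natAdd a j`. [folklore] -/
theorem filter_glue_natAdd {a b x : ℕ} (W : Finset (Fin x)) (φ : Fin x → Fin a) (ψ : Fin x → Fin b)
    (g : Fin x → Fin (a + b)) (hg : ∀ u, g u = if u ∈ W then Fin.natAdd a (ψ u) else Fin.castAdd b (φ u))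
    (j : Fin b) :
    (Finset.univ.filter fun u => g u = Fin.natAdd a j) = W ∩ Finset.univ.filter fun u => ψ u = j := by
  ext u
  simp only [Finset.mem_filter, Finset.mem_univ, true_and, Finset.mem_inter]
  rw [hg u]
  by_cases hu : u ∈ W
  · simp only [hu, ↓reduceIte, true_and, Fin.natAdd_inj]
  · simp only [hu, ↓reduceIte, false_and, iff_false]
    exact Fin.ne_of_val_ne (by simp only [Fin.val_natAdd, Fin.val_castAdd]; omega)

/-- GLUING: the point of the configuration glued from `φ` off `W` and `ψ` on `W` is the `A_W`-summand of `φ` plus the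
`B_W`-summand of `ψ` (split `Σ_{d : Fin (a+b)}` into the two blocks). [folklore] -/
theorem sum_glue {a b x : ℕ} (h : Fin (a + b) → Finset (Fin x) → (Fin 2 →₀ ℕ)) (W : Finset (Fin x))
    (φ : Fin x → Fin a) (ψ : Fin x → Fin b) (g : Fin x → Fin (a + b))
    (hg : ∀ u, g u = if u ∈ W then Fin.natAdd a (ψ u) else Fin.castAdd b (φ u)) :
    ∑ d, h d (Finset.univ.filter fun u => g u = d) =
      (∑ d, h (Fin.castAdd b d) (Wᶜ ∩ Finset.univ.filter fun u => φ u = d)) +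
        ∑ d, h (Fin.natAdd a d) (W ∩ Finset.univ.filter fun u => ψ u = d) := by
  rw [Fin.sum_univ_add]
  simp only [filter_glue_castAdd W φ ψ g hg, filter_glue_natAdd W φ ψ g hg]

/-- SLICING: every configuration `f` is glued, along its own slice `W = {u : a ≤ f u}`, from a first-block
configuration `φ` off `W` and a second-block configuration `ψ` on `W` (`1 ≤ a`, `1 ≤ b` supply the irrelevant default
values). [folklore] -/
theorem exists_glue {a b x : ℕ} (ha : 1 ≤ a) (hb : 1 ≤ b) (f : Fin x → Fin (a + b)) :
    ∃ (W : Finset (Fin x)) (φ : Fin x → Fin a) (ψ : Fin x → Fin b),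
      ∀ u, f u = if u ∈ W then Fin.natAdd a (ψ u) else Fin.castAdd b (φ u) := by
  refine ⟨Finset.univ.filter fun u => a ≤ (f u : ℕ),
    fun u => if hlt : (f u : ℕ) < a then ⟨f u, hlt⟩ else ⟨0, ha⟩,
    fun u => if hle : a ≤ (f u : ℕ) then ⟨(f u : ℕ) - a, by have := (f u).isLt; omega⟩ else ⟨0, hb⟩,
    fun u => ?_⟩
  by_cases hle : a ≤ (f u : ℕ)
  · have hnlt : ¬((f u : ℕ) < a) := Nat.not_lt.mpr hle
    simp only [Finset.mem_filter, Finset.mem_univ, true_and, hle, ↓reduceIte, ↓reduceDIte, Fin.ext_iff,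
      Fin.val_natAdd]
    omega
  · have hlt : (f u : ℕ) < a := Nat.lt_of_not_le hle
    simp only [Finset.mem_filter, Finset.mem_univ, true_and, hle, ↓reduceIte, hlt, ↓reduceDIte, Fin.ext_iff,
      Fin.val_castAdd]

/-- **CORE BOUND** — the registered stub with the three point maps abstracted: `P` (whole design), `PA W` (first
block read off `W`), `PB W` (second block read on `W`).  `|U(im P)| + 2^x ≤ Σ_W (|U(im PA W)| + |U(im PB W)|)`:
slice, glue, and apply the chart lemma for planar sumsets slice by slice. [folklore] -/
theorem core_bound {a b x : ℕ} (ha : 1 ≤ a) (hb : 1 ≤ b) (h : Fin (a + b) → Finset (Fin x) → (Fin 2 →₀ ℕ))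
    (P : (Fin x → Fin (a + b)) → (Fin 2 →₀ ℕ)) (PA : Finset (Fin x) → (Fin x → Fin a) → (Fin 2 →₀ ℕ))
    (PB : Finset (Fin x) → (Fin x → Fin b) → (Fin 2 →₀ ℕ))
    (hP : ∀ f, P f = ∑ d, h d (Finset.univ.filter fun u => f u = d))
    (hPA : ∀ W φ, PA W φ = ∑ d, h (Fin.castAdd b d) (Wᶜ ∩ Finset.univ.filter fun u => φ u = d))
    (hPB : ∀ W ψ, PB W ψ = ∑ d, h (Fin.natAdd a d) (W ∩ Finset.univ.filter fun u => ψ u = d)) :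
    {p : Fin 2 →₀ ℕ | p ∈ Finset.univ.image P ∧ ∃ t : ℝ, ∀ q ∈ Finset.univ.image P, q ≠ p →
        t * ((q 0 : ℕ) : ℝ) + (-1) * ((q 1 : ℕ) : ℝ) < t * ((p 0 : ℕ) : ℝ) + (-1) * ((p 1 : ℕ) : ℝ)}.ncard +
        2 ^ x ≤
      ∑ W : Finset (Fin x),
        ({p : Fin 2 →₀ ℕ | p ∈ Finset.univ.image (PA W) ∧ ∃ t : ℝ, ∀ q ∈ Finset.univ.image (PA W), q ≠ p →
            t * ((q 0 : ℕ) : ℝ) + (-1) * ((q 1 : ℕ) : ℝ) < t * ((p 0 : ℕ) : ℝ) + (-1) * ((p 1 : ℕ) : ℝ)}.ncard +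
          {p : Fin 2 →₀ ℕ | p ∈ Finset.univ.image (PB W) ∧ ∃ t : ℝ, ∀ q ∈ Finset.univ.image (PB W), q ≠ p →
            t * ((q 0 : ℕ) : ℝ) + (-1) * ((q 1 : ℕ) : ℝ) < t * ((p 0 : ℕ) : ℝ) + (-1) * ((p 1 : ℕ) : ℝ)}.ncard) := by
  -- the chart set `U W` of the sumset `A_W ⊕ B_W` of the slice `W`
  obtain ⟨U, hU⟩ : ∃ U : Finset (Fin x) → Set (Fin 2 →₀ ℕ), ∀ W, U W =
      {p : Fin 2 →₀ ℕ | p ∈ (Finset.univ.image (PA W) ×ˢ Finset.univ.image (PB W)).image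
            (fun pq : (Fin 2 →₀ ℕ) × (Fin 2 →₀ ℕ) => pq.1 + pq.2) ∧
        ∃ t : ℝ, ∀ q ∈ (Finset.univ.image (PA W) ×ˢ Finset.univ.image (PB W)).image
            (fun pq : (Fin 2 →₀ ℕ) × (Fin 2 →₀ ℕ) => pq.1 + pq.2), q ≠ p →
          t * ((q 0 : ℕ) : ℝ) + (-1) * ((q 1 : ℕ) : ℝ) < t * ((p 0 : ℕ) : ℝ) + (-1) * ((p 1 : ℕ) : ℝ)} :=
    ⟨_, fun _ => rfl⟩
  -- the factor clouds are nonempty (`1 ≤ a`, `1 ≤ b`: constant configurations exist)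
  have hAne : ∀ W, (Finset.univ.image (PA W)).Nonempty := fun W =>
    ⟨_, Finset.mem_image_of_mem _ (Finset.mem_univ fun _ : Fin x => (⟨0, ha⟩ : Fin a))⟩
  have hBne : ∀ W, (Finset.univ.image (PB W)).Nonempty := fun W =>
    ⟨_, Finset.mem_image_of_mem _ (Finset.mem_univ fun _ : Fin x => (⟨0, hb⟩ : Fin b))⟩
  -- GLUING BACK: every point of a slice sumset is the point of a configuration
  have hsumsub : ∀ (W : Finset (Fin x)) (q : Fin 2 →₀ ℕ),
      q ∈ (Finset.univ.image (PA W) ×ˢ Finset.univ.image (PB W)).image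
        (fun pq : (Fin 2 →₀ ℕ) × (Fin 2 →₀ ℕ) => pq.1 + pq.2) → q ∈ Finset.univ.image P := by
    intro W q hq
    obtain ⟨p₁, hp₁, p₂, hp₂, rfl⟩ := SumsetChartCountAux.mem_sumset_iff.mp hq
    obtain ⟨φ, -, rfl⟩ := Finset.mem_image.mp hp₁
    obtain ⟨ψ, -, rfl⟩ := Finset.mem_image.mp hp₂
    refine Finset.mem_image.mpr
      ⟨fun u => if u ∈ W then Fin.natAdd a (ψ u) else Fin.castAdd b (φ u), Finset.mem_univ _, ?_⟩
    rw [hP, hPA, hPB]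
    exact sum_glue h W φ ψ _ fun _ => rfl
  -- each chart set is finite
  have hfin : ∀ W, (U W).Finite := fun W => by
    rw [hU]
    exact (Finset.finite_toSet _).subset fun p hp => hp.1
  -- SLICING: a chart point of the whole cloud is a chart point (same `t`) of the sumset of its own slice
  have hsub : {p : Fin 2 →₀ ℕ | p ∈ Finset.univ.image P ∧ ∃ t : ℝ, ∀ q ∈ Finset.univ.image P, q ≠ p →
      t * ((q 0 : ℕ) : ℝ) + (-1) * ((q 1 : ℕ) : ℝ) < t * ((p 0 : ℕ) : ℝ) + (-1) * ((p 1 : ℕ) : ℝ)} ⊆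
      ⋃ W, U W := by
    rintro p ⟨hp, t, ht⟩
    obtain ⟨f, -, rfl⟩ := Finset.mem_image.mp hp
    obtain ⟨W, φ, ψ, hf⟩ := exists_glue ha hb f
    refine Set.mem_iUnion.mpr ⟨W, ?_⟩
    rw [hU, Set.mem_setOf_eq]
    refine ⟨?_, t, fun q hq hne => ht q (hsumsub W q hq) hne⟩
    rw [hP, sum_glue h W φ ψ f hf, ← hPA, ← hPB]
    exact SumsetChartCountAux.add_mem_sumset (Finset.mem_image_of_mem _ (Finset.mem_univ _))
      (Finset.mem_image_of_mem _ (Finset.mem_univ _))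
  -- COUNTING over the `2 ^ x` slices with the chart lemma for planar sumsets (`σ = -1`)
  have h1 := (Set.ncard_le_ncard hsub (Set.finite_iUnion hfin)).trans (Set.ncard_iUnion_le_of_fintype U)
  have hσ : (-1 : ℝ) ≠ 0 := by norm_num
  calc _ ≤ (∑ W, (U W).ncard) + 2 ^ x := Nat.add_le_add_right h1 _
    _ = ∑ W, ((U W).ncard + 1) := by rw [Finset.sum_add_distrib, FourCoreSplittingAux.sum_one_eq]
    _ ≤ _ := Finset.sum_le_sum fun W _ => by
      rw [hU]
      exact stub_sumsetChartCount (-1) hσ _ _ (hAne W) (hBne W)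

end CoreSplittingAux

/-- **STUB P7 `stub_coreSplitting`** (registered signature, verbatim) — the MINKOWSKI SPLITTING THEOREM for a design
on `c = a + b` cores in chart language: the lower-hull vertices (chart points, `σ = -1`) of the cloud of all
configurations, plus `2^x`, number at most the sum over the slices `W ⊆ [x]` of the chart-point counts of the two
sub-design clouds (first `a` cores read off `W`, last `b` cores read on `W`). [folklore] -/
theorem stub_coreSplitting (a b x : ℕ) (ha : 1 ≤ a) (hb : 1 ≤ b) (h : Fin (a + b) → Finset (Fin x) → (Fin 2 →₀ ℕ)) :
    {p : Fin 2 →₀ ℕ | p ∈ (Finset.univ.image fun f : Fin x → Fin (a + b) =>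
          ∑ d, h d (Finset.univ.filter fun u => f u = d)) ∧
        ∃ t : ℝ, ∀ q ∈ (Finset.univ.image fun f : Fin x → Fin (a + b) =>
          ∑ d, h d (Finset.univ.filter fun u => f u = d)), q ≠ p →
          t * ((q 0 : ℕ) : ℝ) + (-1) * ((q 1 : ℕ) : ℝ) < t * ((p 0 : ℕ) : ℝ) + (-1) * ((p 1 : ℕ) : ℝ)}.ncard + 2 ^ x ≤
      ∑ W : Finset (Fin x),
        ({p : Fin 2 →₀ ℕ | p ∈ (Finset.univ.image fun φ : Fin x → Fin a =>
              ∑ d, h (Fin.castAdd b d) (Wᶜ ∩ Finset.univ.filter fun u => φ u = d)) ∧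
            ∃ t : ℝ, ∀ q ∈ (Finset.univ.image fun φ : Fin x → Fin a =>
              ∑ d, h (Fin.castAdd b d) (Wᶜ ∩ Finset.univ.filter fun u => φ u = d)), q ≠ p →
              t * ((q 0 : ℕ) : ℝ) + (-1) * ((q 1 : ℕ) : ℝ) < t * ((p 0 : ℕ) : ℝ) + (-1) * ((p 1 : ℕ) : ℝ)}.ncard +
         {p : Fin 2 →₀ ℕ | p ∈ (Finset.univ.image fun ψ : Fin x → Fin b =>
              ∑ d, h (Fin.natAdd a d) (W ∩ Finset.univ.filter fun u => ψ u = d)) ∧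
            ∃ t : ℝ, ∀ q ∈ (Finset.univ.image fun ψ : Fin x → Fin b =>
              ∑ d, h (Fin.natAdd a d) (W ∩ Finset.univ.filter fun u => ψ u = d)), q ≠ p →
              t * ((q 0 : ℕ) : ℝ) + (-1) * ((q 1 : ℕ) : ℝ) < t * ((p 0 : ℕ) : ℝ) + (-1) * ((p 1 : ℕ) : ℝ)}.ncard) := by
  exact CoreSplittingAux.core_bound ha hb h (fun f => ∑ d, h d (Finset.univ.filter fun u => f u = d))
    (fun W φ => ∑ d, h (Fin.castAdd b d) (Wᶜ ∩ Finset.univ.filter fun u => φ u = d))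
    (fun W ψ => ∑ d, h (Fin.natAdd a d) (W ∩ Finset.univ.filter fun u => ψ u = d))
    (fun _ => rfl) (fun _ _ => rfl) (fun _ _ => rfl)

end Summit.ValiantsHypothesis.ValiantsHypothesis.Theorems.NewtonUnitEquationsNewtonTauWeak
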